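import Literature.NumberTheory.Sieve.GreenTao2006EnvelopingSieveFourier
import Literature.NumberTheory.Sieve.SquarefreeDivisorMoments
import Literature.NumberTheory.LFunctions.MertensTail
import HarnessLib

/-!
# Green–Tao (2006): size bounds for the enveloping sieve `β_R` (monic tuples)

B. Green, T. Tao, *Restriction theory of the Selberg sieve, with applications*, JTNB **18** (2006)
[GreenTao2006Restriction], Prop. 3.1 (i)–(ii) and the proof of Prop. 3.1 in Appendix §7, for
`F(n) = ∏_{h ∈ H}(n + h)`.  Fifth layer of the proof of the named fact
`Literature.NumberTheory.Sieve.GreenTao2006_envelopingSieve_extension`; everything is PROVED.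

* `selbergG_le_exp` — `G(R) ≤ exp(4k²(log log R + 4))` (`G(R) ≤ ∏_{p ≤ R}(1 + h_p)`, `h_p ≤ 4k²/p`,
  Mertens); GT (7.21)–(7.22) in crude form.
* `divCount_le_prod_card` — `d_R(n) ≤ ∏_{h ∈ H} τ♭_R(|n+h|)` when no `n + h` vanishes, and
  `sum_pow_beta_le` — the moment bound `∑_{n=1}^{N} β(n)^s ≤ 4k G(R)^s e^{…} N` for the sieve
  `β = β_R · 1[F(n) ≠ 0]` (replaces GT Prop. 3.1 (ii) `β_R(n) ≪_ε N^ε`, which fails at the roots of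
  `F`);
* `pow_card_le_mul_rpow` — `L^{ω(q)} ≤ L^{⌊L^{1/ε}⌋+1} q^ε` for squarefree `q`, turning the
  coefficient bound `|w(c)| ≤ (32k²)^{ω(q)}/q` into `≪_{k,ε} q^{ε-1}` (GT (3.3));
* `selbergG_ge` — **GT Prop. 3.1 (i)**: `G(R) ≥ c_k (log R)^k / 𝔖(H)` for `R ≥ R₀(k)`, by Rankin's
  trick (`G(R) ≥ ∑_{S ⊆ {p<z}} h(S) - R^{-σ} ∑_S h(S) (∏S)^σ`, `z = R^{1/m}`, `σ = 1/log z`) and the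
  comparison `∏_{p<z}(1 + h_p) = ∏_{p<z}(1 - ν_p/p)⁻¹ ≥ ½ 𝔖(H)⁻¹ ∏_{p<z}(1 - 1/p)^{-k}` with the
  tree's Mertens bounds (`MertensBound.sum_log_div_prime_le`, `prod_one_sub_inv_prime_Icc_le`) and
  singular-series API (`SingularSeries.lean`); this is the bound "`G(R) ≫_k ∏_{p<R} γ(p)⁻¹`"
  that GT quote from Halberstam–Richert.

## References

* [GreenTao2006Restriction] Green–Tao, JTNB 18 (2006), Prop. 3.1 and its proof in §7
  ((7.20)–(7.22)) (arXiv:math/0405581).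
* H. Halberstam, H.-E. Richert, *Sieve Methods* (1974), Ch. 2 and (5.2.5) (the lower bound for
  `G(z)`).
-/

noncomputable section

open Finset Real

namespace Literature.NumberTheory.Sieve

namespace GreenTao2006

variable {H : Finset ℤ}

/-! ### Upper bound for `G(R)` -/

/-- `G(R) ≤ ∏_{p ≤ R} (1 + h_p)`. [cite: GreenTao2006Restriction, (7.22)] -/
theorem selbergG_le_prod (R : ℕ) :
    selbergG H R ≤ ∏ p ∈ Nat.primesLE R, (1 + localH H p) := by
  rw [Finset.prod_one_add, selbergG]
  refine Finset.sum_le_sum_of_subset_of_nonneg (Finset.filter_subset _ _) fun S hS _ => ?_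
  exact Finset.prod_nonneg fun p hp =>
    localH_nonneg (Nat.prime_of_mem_primesLE (Finset.mem_powerset.1 hS hp)).pos

/-- **Crude upper bound for `G(R)`**: `G(R) ≤ exp(4k² (log log R + 4))` for an admissible
`k`-tuple (`k ≥ 1`) and `R ≥ 2`. [cite: GreenTao2006Restriction, (7.21)–(7.22)] -/
theorem selbergG_le_exp (hadm : IsAdmissibleTuple H) (hk : 1 ≤ H.card) {R : ℕ} (hR : 2 ≤ R) :
    selbergG H R ≤ Real.exp (4 * (H.card : ℝ) ^ 2 * (Real.log (Real.log R) + 4)) := by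
  refine (selbergG_le_prod R).trans ?_
  have h1 : ∏ p ∈ Nat.primesLE R, (1 + localH H p) ≤
      ∏ p ∈ Nat.primesLE R, (1 + 4 * (H.card : ℝ) ^ 2 / p) := by
    refine Finset.prod_le_prod (fun p hp => ?_) fun p hp => ?_
    · have := localH_nonneg (H := H) (Nat.prime_of_mem_primesLE hp).pos; linarith
    · exact add_le_add le_rfl (localH_le hadm hk (Nat.prime_of_mem_primesLE hp))
  exact h1.trans (Literature.NumberTheory.Sieve.prod_one_add_div_le_exp (by positivity) hR)

/-! ### The restricted squarefree divisor count of `F(n)` -/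

/-- Submultiplicativity of the restricted squarefree divisor count:
`τ♭_R(ab) ≤ τ♭_R(a) τ♭_R(b)` (`d ↦ (gcd(d,a), d/gcd(d,a))`). [folklore] -/
theorem card_sqfree_dvd_mul_le (R a b : ℕ) :
    ((Icc 1 R).filter (fun d => Squarefree d ∧ d ∣ a * b)).card ≤
      ((Icc 1 R).filter (fun d => Squarefree d ∧ d ∣ a)).card *
        ((Icc 1 R).filter (fun d => Squarefree d ∧ d ∣ b)).card := by
  classical
  rw [← Finset.card_product]
  refine Finset.card_le_card_of_injOn (fun d => (Nat.gcd d a, d / Nat.gcd d a)) ?_ ?_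
  · intro d hd
    rw [Finset.mem_coe, Finset.mem_filter, Finset.mem_Icc] at hd
    obtain ⟨⟨hd1, hdR⟩, hsq, hdvd⟩ := hd
    set d₁ := Nat.gcd d a with hd₁
    have hd₁d : d₁ ∣ d := Nat.gcd_dvd_left d a
    have hd₁pos : 0 < d₁ := Nat.gcd_pos_of_pos_left a (by omega)
    have hmul : d / d₁ * d₁ = d := Nat.div_mul_cancel hd₁d
    have hd₂d : d / d₁ ∣ d := Nat.div_dvd_of_dvd hd₁d
    have hd₂pos : 0 < d / d₁ := Nat.div_pos (Nat.le_of_dvd (by omega) hd₁d) hd₁pos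
    have hcop : Nat.Coprime d₁ (d / d₁) := by
      refine Nat.coprime_of_squarefree_mul ?_
      rwa [mul_comm, hmul]
    have hcop2 : Nat.Coprime (d / d₁) a := by
      rw [Nat.coprime_iff_gcd_eq_one]
      set g := Nat.gcd (d / d₁) a with hg
      have hg1 : g ∣ d₁ := Nat.dvd_gcd ((Nat.gcd_dvd_left _ _).trans hd₂d) (Nat.gcd_dvd_right _ _)
      have hg2 : g ∣ d / d₁ := Nat.gcd_dvd_left _ _
      exact Nat.Coprime.eq_one_of_dvd (Nat.Coprime.coprime_dvd_left hg1 hcop) hg2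
    have hd₂b : d / d₁ ∣ b := hcop2.dvd_of_dvd_mul_left (hd₂d.trans hdvd)
    simp only [Finset.coe_product, Set.mem_prod, Finset.mem_coe, Finset.mem_filter, Finset.mem_Icc]
    refine ⟨⟨⟨hd₁pos, (Nat.le_of_dvd (by omega) hd₁d).trans hdR⟩, hsq.squarefree_of_dvd hd₁d,
      Nat.gcd_dvd_right d a⟩, ⟨hd₂pos, (Nat.le_of_dvd (by omega) hd₂d).trans hdR⟩,
      hsq.squarefree_of_dvd hd₂d, hd₂b⟩
  · intro d hd d' hd' h
    simp only [Prod.mk.injEq] at h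
    have h1 : d / Nat.gcd d a * Nat.gcd d a = d := Nat.div_mul_cancel (Nat.gcd_dvd_left d a)
    have h2 : d' / Nat.gcd d' a * Nat.gcd d' a = d' := Nat.div_mul_cancel (Nat.gcd_dvd_left d' a)
    calc d = d / Nat.gcd d a * Nat.gcd d a := h1.symm
      _ = d' / Nat.gcd d' a * Nat.gcd d' a := by rw [h.2, h.1]
      _ = d' := h2

/-- `τ♭_R(∏_{h ∈ H} m_h) ≤ ∏_{h ∈ H} τ♭_R(m_h)`. [folklore] -/
theorem card_sqfree_dvd_prod_le {ι : Type*} (R : ℕ) (s : Finset ι) (m : ι → ℕ) :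
    ((Icc 1 R).filter (fun d => Squarefree d ∧ d ∣ ∏ i ∈ s, m i)).card ≤
      ∏ i ∈ s, ((Icc 1 R).filter (fun d => Squarefree d ∧ d ∣ m i)).card := by
  classical
  induction s using Finset.induction_on with
  | empty =>
    rw [Finset.prod_empty, Finset.prod_empty]
    refine (Finset.card_le_card (t := {1}) ?_).trans (by simp)
    intro d hd
    rw [Finset.mem_filter, Nat.dvd_one] at hd
    rw [Finset.mem_singleton]; exact hd.2.2
  | insert a s ha ih =>
    rw [Finset.prod_insert ha, Finset.prod_insert ha]
    exact (card_sqfree_dvd_mul_le R _ _).trans (Nat.mul_le_mul_left _ ih)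

/-- `|∏ᵢ zᵢ| = ∏ᵢ |zᵢ|` for integers (`natAbs`). [folklore] -/
theorem natAbs_prod {ι : Type*} (s : Finset ι) (z : ι → ℤ) :
    (∏ i ∈ s, z i).natAbs = ∏ i ∈ s, (z i).natAbs := by
  classical
  induction s using Finset.induction_on with
  | empty => simp
  | insert a s ha ih => rw [Finset.prod_insert ha, Finset.prod_insert ha, Int.natAbs_mul, ih]

/-- **`d_R(n) ≤ ∏_{h ∈ H} τ♭_R(|n + h|)`**: a set `M ⊆ Z(n)` of primes with `∏ M ≤ R` gives the
squarefree divisor `∏ M ≤ R` of `F(n) = ∏_h (n+h)`, and `τ♭_R` is submultiplicative.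
[cite: GreenTao2006Restriction, proof of Prop. 3.1 (ii) ("`β(n) ≤ G(R) d(F(n))²`")] -/
theorem divCount_le_prod_card (R : ℕ) (n : ℤ) :
    divCount H R n ≤
      ∏ h ∈ H, ((Icc 1 R).filter (fun d => Squarefree d ∧ d ∣ (n + h).natAbs)).card := by
  classical
  -- step 1: inject into the squarefree divisors `≤ R` of `|F(n)|`
  have h1 : divCount H R n ≤
      ((Icc 1 R).filter (fun d => Squarefree d ∧ d ∣ (∏ h ∈ H, (n + h)).natAbs)).card := by
    unfold divCount
    refine Finset.card_le_card_of_injOn (fun M => ∏ p ∈ M, p) ?_ ?_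
    · intro M hM
      rw [Finset.mem_coe, Finset.mem_filter, Finset.mem_powerset] at hM
      have hprime : ∀ p ∈ M, p.Prime := fun p hp =>
        Nat.prime_of_mem_primesLE (mem_badPrimes.1 (hM.1 hp)).1
      have hsq : Squarefree (∏ p ∈ M, p) := by
        have key : ∀ s : Finset ℕ, (∀ p ∈ s, p.Prime) → Squarefree (∏ p ∈ s, p) := by
          intro s
          induction s using Finset.induction_on with
          | empty => intro _; simp
          | insert a s ha ih =>
            intro hs
            rw [Finset.prod_insert ha]
            have hap : a.Prime := hs a (Finset.mem_insert_self a s)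
            have hs' : ∀ p ∈ s, p.Prime := fun p hp => hs p (Finset.mem_insert_of_mem hp)
            have hcop : a.Coprime (∏ p ∈ s, p) := by
              refine Nat.Coprime.prod_right fun p hp => (Nat.coprime_primes hap (hs' p hp)).2 ?_
              rintro rfl; exact ha hp
            exact (Nat.squarefree_mul hcop).2 ⟨hap.squarefree, ih hs'⟩
        exact key M hprime
      rw [Finset.mem_coe, Finset.mem_filter, Finset.mem_Icc]
      refine ⟨⟨Finset.prod_pos fun p hp => (hprime p hp).pos, hM.2⟩, hsq, ?_⟩
      -- `∏ M ∣ |F(n)|`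
      refine Finset.prod_primes_dvd _ (fun p hp => (hprime p hp).prime) (fun p hp => ?_)
      obtain ⟨h, hh, hdvd⟩ := (mem_badPrimes.1 (hM.1 hp)).2
      rw [← Int.natCast_dvd]
      exact hdvd.trans (Finset.dvd_prod_of_mem _ hh)
    · intro M hM M' hM' heq
      rw [Finset.mem_coe, Finset.mem_filter, Finset.mem_powerset] at hM hM'
      have hp : ∀ p ∈ M, p.Prime := fun p hp => Nat.prime_of_mem_primesLE (mem_badPrimes.1 (hM.1 hp)).1
      have hp' : ∀ p ∈ M', p.Prime := fun p hp => Nat.prime_of_mem_primesLE (mem_badPrimes.1 (hM'.1 hp)).1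
      simp only at heq
      rw [← Nat.primeFactors_prod hp, ← Nat.primeFactors_prod hp', heq]
  refine h1.trans ?_
  rw [natAbs_prod]
  exact card_sqfree_dvd_prod_le R H _


/-! ### The moment bound for `β = β_R · 1[F(n) ≠ 0]` -/

/-- Pointwise: `β(n)^s ≤ G(R)^s ∑_{h ∈ H} 1[n+h ≠ 0] τ♭_R(|n+h|)^{2s|H|}` for the sieve
`β = β_R · 1[F(n) ≠ 0]` (`s ≥ 1`). [cite: GreenTao2006Restriction, proof of Prop. 3.1 (ii)] -/
theorem pow_beta_le (hadm : IsAdmissibleTuple H) (hk : 1 ≤ H.card) {R : ℕ} (hR : 1 ≤ R) {s : ℕ}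
    (hs : 1 ≤ s) (n : ℤ) :
    (if ∃ h ∈ H, n + h = 0 then 0 else betaR H R n) ^ s ≤
      selbergG H R ^ s * ∑ h ∈ H,
        (if n + h = 0 then 0 else
          ((((Icc 1 R).filter (fun d => Squarefree d ∧ d ∣ (n + h).natAbs)).card : ℝ)) ^ (2 * s * H.card)) := by
  have hG := selbergG_pos (H := H) hR
  split_ifs with hroot
  · rw [zero_pow (by omega)]
    exact mul_nonneg (pow_nonneg hG.le _) (Finset.sum_nonneg fun h _ => by
      split_ifs <;> positivity)
  · push Not at hroot
    have hH : H.Nonempty := Finset.card_pos.1 hk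
    set τ : ℤ → ℝ := fun h => ((((Icc 1 R).filter (fun d => Squarefree d ∧ d ∣ (n + h).natAbs)).card : ℝ))
      with hτ
    have hτ0 : ∀ h, 0 ≤ τ h := fun h => by rw [hτ]; positivity
    have h1 : betaR H R n ≤ selbergG H R * (∏ h ∈ H, τ h) ^ 2 := by
      refine (betaR_le hadm hR n).trans (mul_le_mul_of_nonneg_left ?_ hG.le)
      refine pow_le_pow_left₀ (Nat.cast_nonneg _) ?_ 2
      simp only [hτ]
      exact_mod_cast divCount_le_prod_card (H := H) R n
    have h2 : (∏ h ∈ H, τ h) ^ (2 * s) ≤ ∑ h ∈ H, τ h ^ (2 * s * H.card) := by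
      rw [← Finset.prod_pow]
      -- `∏_h a_h ≤ ∑_h a_h^{|H|}` for `a_h = τ(h)^{2s} ≥ 0` (cf. the tree's `prod_le_sum_pow_card`)
      obtain ⟨h₀, hh₀, hmax⟩ := Finset.exists_max_image H (fun h => τ h ^ (2 * s)) hH
      calc ∏ h ∈ H, τ h ^ (2 * s) ≤ ∏ _h ∈ H, τ h₀ ^ (2 * s) :=
            Finset.prod_le_prod (fun h _ => pow_nonneg (hτ0 h) _) fun h hh => hmax h hh
        _ = (τ h₀ ^ (2 * s)) ^ H.card := Finset.prod_const _
        _ = τ h₀ ^ (2 * s * H.card) := by rw [← pow_mul]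
        _ ≤ ∑ h ∈ H, τ h ^ (2 * s * H.card) :=
            Finset.single_le_sum (f := fun h => τ h ^ (2 * s * H.card))
              (fun h _ => pow_nonneg (hτ0 h) _) hh₀
    calc betaR H R n ^ s ≤ (selbergG H R * (∏ h ∈ H, τ h) ^ 2) ^ s :=
          pow_le_pow_left₀ (betaR_nonneg R n) h1 s
      _ = selbergG H R ^ s * (∏ h ∈ H, τ h) ^ (2 * s) := by rw [mul_pow, ← pow_mul]
      _ ≤ selbergG H R ^ s * ∑ h ∈ H, τ h ^ (2 * s * H.card) :=
          mul_le_mul_of_nonneg_left h2 (pow_nonneg hG.le _)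
      _ = _ := by
          congr 1
          refine Finset.sum_congr rfl fun h hh => ?_
          rw [if_neg (hroot h hh)]

/-- Shifted sums of a function of `|n + h|` over `1 ≤ n ≤ N` (`|h| ≤ N`), omitting `n + h = 0`:
`∑_{n=1}^{N} 1[n+h≠0] g(|n+h|) ≤ 2 ∑_{m=1}^{2N} g(m)` for `g ≥ 0`. [folklore] -/
theorem sum_shift_le (g : ℕ → ℝ) (hg : ∀ m, 0 ≤ g m) {N : ℕ} {h : ℤ} (hh : |h| ≤ (N : ℤ)) :
    ∑ n ∈ Icc 1 N, (if (n : ℤ) + h = 0 then 0 else g ((n : ℤ) + h).natAbs) ≤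
      2 * ∑ m ∈ Icc 1 (2 * N), g m := by
  classical
  rw [← Finset.sum_filter_add_sum_filter_not (Icc 1 N) (fun n : ℕ => (n : ℤ) + h = 0)]
  have h0 : ∑ n ∈ (Icc 1 N).filter (fun n : ℕ => (n : ℤ) + h = 0),
      (if (n : ℤ) + h = 0 then 0 else g ((n : ℤ) + h).natAbs) = 0 :=
    Finset.sum_eq_zero fun n hn => by rw [if_pos (Finset.mem_filter.1 hn).2]
  rw [h0, zero_add]
  set S := (Icc 1 N).filter (fun n : ℕ => ¬ (n : ℤ) + h = 0) with hS
  have h1 : ∑ n ∈ S, (if (n : ℤ) + h = 0 then 0 else g ((n : ℤ) + h).natAbs) =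
      ∑ n ∈ S, g ((n : ℤ) + h).natAbs :=
    Finset.sum_congr rfl fun n hn => by rw [if_neg (Finset.mem_filter.1 hn).2]
  rw [h1]
  have hmaps : ∀ n ∈ S, ((n : ℤ) + h).natAbs ∈ Icc 1 (2 * N) := by
    intro n hn
    rw [hS, Finset.mem_filter, Finset.mem_Icc] at hn
    rw [Finset.mem_Icc]
    rw [abs_le] at hh
    constructor <;> omega
  rw [← Finset.sum_fiberwise_of_maps_to hmaps, Finset.mul_sum]
  refine Finset.sum_le_sum fun m hm => ?_
  have h2 : ∑ n ∈ S.filter (fun n : ℕ => ((n : ℤ) + h).natAbs = m), g ((n : ℤ) + h).natAbs =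
      (S.filter (fun n : ℕ => ((n : ℤ) + h).natAbs = m)).card * g m := by
    rw [Finset.sum_congr rfl fun n hn => by rw [(Finset.mem_filter.1 hn).2], Finset.sum_const,
      nsmul_eq_mul]
  rw [h2]
  refine mul_le_mul_of_nonneg_right ?_ (hg m)
  have hsub : S.filter (fun n : ℕ => ((n : ℤ) + h).natAbs = m) ⊆
      {((m : ℤ) - h).toNat, (-(m : ℤ) - h).toNat} := by
    intro n hn
    rw [Finset.mem_filter] at hn
    rw [Finset.mem_insert, Finset.mem_singleton]
    omega
  exact_mod_cast (Finset.card_le_card hsub).trans Finset.card_le_two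

/-- **Moment bound for the enveloping sieve** `β = β_R · 1[F(n) ≠ 0]`: for `s ≥ 1`, `R ≥ 2` and
`|h| ≤ N` on `H`,
`∑_{n=1}^{N} β(n)^s ≤ 4k G(R)^s exp((2^{2sk} - 1)(log log R + 4)) N`.
[cite: GreenTao2006Restriction, Prop. 3.1 (ii) (replacement: moment bound instead of `N^ε`)] -/
theorem sum_pow_beta_le (hadm : IsAdmissibleTuple H) (hk : 1 ≤ H.card) {R N : ℕ} (hR : 2 ≤ R)
    (hH : ∀ h ∈ H, |h| ≤ (N : ℤ)) {s : ℕ} (hs : 1 ≤ s) :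
    ∑ n ∈ Icc 1 N, (if ∃ h ∈ H, (n : ℤ) + h = 0 then 0 else betaR H R n) ^ s ≤
      4 * H.card * selbergG H R ^ s *
        Real.exp (((2 : ℝ) ^ (2 * s * H.card) - 1) * (Real.log (Real.log R) + 4)) * N := by
  have hR1 : 1 ≤ R := by omega
  have hG := selbergG_pos (H := H) hR1
  set r : ℕ := 2 * s * H.card with hr
  set E : ℝ := Real.exp (((2 : ℝ) ^ r - 1) * (Real.log (Real.log R) + 4)) with hE
  set τN : ℕ → ℝ := fun m => ((((Icc 1 R).filter (fun d => Squarefree d ∧ d ∣ m)).card : ℝ)) ^ r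
    with hτN
  have hτN0 : ∀ m, 0 ≤ τN m := fun m => by rw [hτN]; positivity
  have hmom : ∑ m ∈ Icc 1 (2 * N), τN m ≤ (2 * N : ℕ) * E := by
    have := Literature.NumberTheory.Sieve.sum_pow_card_sqfreeDivisors_le r hR (2 * N)
    simp only [hτN, hE]
    exact this
  calc ∑ n ∈ Icc 1 N, (if ∃ h ∈ H, (n : ℤ) + h = 0 then 0 else betaR H R n) ^ s
      ≤ ∑ n ∈ Icc 1 N, selbergG H R ^ s * ∑ h ∈ H,
          (if (n : ℤ) + h = 0 then 0 else τN ((n : ℤ) + h).natAbs) :=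
        Finset.sum_le_sum fun n _ => pow_beta_le hadm hk hR1 hs n
    _ = selbergG H R ^ s * ∑ h ∈ H, ∑ n ∈ Icc 1 N,
          (if (n : ℤ) + h = 0 then 0 else τN ((n : ℤ) + h).natAbs) := by
        rw [← Finset.mul_sum, Finset.sum_comm]
    _ ≤ selbergG H R ^ s * ∑ h ∈ H, 2 * ∑ m ∈ Icc 1 (2 * N), τN m := by
        refine mul_le_mul_of_nonneg_left (Finset.sum_le_sum fun h hh => ?_) (pow_nonneg hG.le _)
        exact sum_shift_le τN hτN0 (hH h hh)
    _ ≤ selbergG H R ^ s * ∑ h ∈ H, 2 * ((2 * N : ℕ) * E) := by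
        refine mul_le_mul_of_nonneg_left (Finset.sum_le_sum fun h _ => ?_) (pow_nonneg hG.le _)
        linarith
    _ = 4 * H.card * selbergG H R ^ s * E * N := by
        rw [Finset.sum_const, nsmul_eq_mul]; push_cast; ring

/-! ### From `(32k²)^{ω(q)}/q` to `q^{ε-1}` -/

/-- For `L ≥ 1`, `ε > 0` and a finite set `D` of positive integers:
`L^{|D|} ≤ L^{⌊L^{1/ε}⌋+1} (∏_{p ∈ D} p)^ε` (split `D` at `L^{1/ε}`: each large `p` has `p^ε ≥ L`,
and there are at most `⌊L^{1/ε}⌋ + 1` small ones). [cite: GreenTao2006Restriction, end of §7 (proof of (3.3))] -/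
theorem pow_card_le_mul_rpow {L ε : ℝ} (hL : 1 ≤ L) (hε : 0 < ε) (D : Finset ℕ)
    (hD : ∀ p ∈ D, 1 ≤ p) :
    L ^ D.card ≤ L ^ (⌊L ^ (1 / ε)⌋₊ + 1) * ((∏ p ∈ D, p : ℕ) : ℝ) ^ ε := by
  classical
  set x : ℝ := L ^ (1 / ε) with hx
  have hx0 : 0 ≤ x := Real.rpow_nonneg (by linarith) _
  set D₁ := D.filter (fun p : ℕ => (p : ℝ) < x) with hD₁
  set D₂ := D.filter (fun p : ℕ => ¬ (p : ℝ) < x) with hD₂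
  have hcard : D.card = D₁.card + D₂.card :=
    (Finset.card_filter_add_card_filter_not (s := D) (fun p : ℕ => (p : ℝ) < x)).symm
  -- small primes
  have h1 : D₁.card ≤ ⌊x⌋₊ + 1 := by
    have : D₁ ⊆ range (⌊x⌋₊ + 1) := by
      intro p hp
      rw [hD₁, Finset.mem_filter] at hp
      rw [Finset.mem_range, Nat.lt_add_one_iff]
      exact Nat.le_floor hp.2.le
    exact (Finset.card_le_card this).trans (by rw [Finset.card_range])
  -- large primes
  have h2 : L ^ D₂.card ≤ ∏ p ∈ D, ((p : ℕ) : ℝ) ^ ε := by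
    calc L ^ D₂.card = ∏ _p ∈ D₂, L := (Finset.prod_const L).symm
      _ ≤ ∏ p ∈ D₂, ((p : ℕ) : ℝ) ^ ε := by
          refine Finset.prod_le_prod (fun _ _ => by linarith) fun p hp => ?_
          rw [hD₂, Finset.mem_filter, not_lt] at hp
          calc L = x ^ ε := by
                rw [hx, ← Real.rpow_mul (by linarith), one_div, inv_mul_cancel₀ hε.ne', Real.rpow_one]
            _ ≤ ((p : ℕ) : ℝ) ^ ε := Real.rpow_le_rpow hx0 hp.2 hε.le
      _ ≤ ∏ p ∈ D, ((p : ℕ) : ℝ) ^ ε := by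
          rw [← Finset.prod_filter_mul_prod_filter_not D (fun p : ℕ => (p : ℝ) < x)]
          have h1' : 1 ≤ ∏ p ∈ D₁, ((p : ℕ) : ℝ) ^ ε := by
            calc (1 : ℝ) = ∏ _p ∈ D₁, (1 : ℝ) := Finset.prod_const_one.symm
              _ ≤ _ := Finset.prod_le_prod (fun _ _ => zero_le_one) fun p hp =>
                  Real.one_le_rpow (by exact_mod_cast hD p (Finset.mem_filter.1 hp).1) hε.le
          have h2' : 0 ≤ ∏ p ∈ D₂, ((p : ℕ) : ℝ) ^ ε := Finset.prod_nonneg fun p _ => by positivity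
          calc ∏ p ∈ D₂, ((p : ℕ) : ℝ) ^ ε = 1 * ∏ p ∈ D₂, ((p : ℕ) : ℝ) ^ ε := (one_mul _).symm
            _ ≤ (∏ p ∈ D₁, ((p : ℕ) : ℝ) ^ ε) * ∏ p ∈ D₂, ((p : ℕ) : ℝ) ^ ε :=
                mul_le_mul_of_nonneg_right h1' h2'
  rw [hcard, pow_add, Nat.cast_prod, ← Real.finsetProd_rpow _ _ fun p _ => Nat.cast_nonneg _]
  exact mul_le_mul (pow_le_pow_right₀ hL h1) h2 (by positivity) (by positivity)


/-! ### The lower bound `G(R) ≫_k (log R)^k / 𝔖(H)` (GT Prop. 3.1 (i)) -/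

/-- `exp t ≤ 1 + (e - 1) t` for `0 ≤ t ≤ 1` (convexity). [folklore] -/
theorem exp_le_one_add_mul {t : ℝ} (h0 : 0 ≤ t) (h1 : t ≤ 1) :
    Real.exp t ≤ 1 + (Real.exp 1 - 1) * t := by
  have h := convexOn_exp.2 (Set.mem_univ (1 : ℝ)) (Set.mem_univ (0 : ℝ)) h0 (by linarith : 0 ≤ 1 - t)
    (by ring)
  simp only [smul_eq_mul, mul_one, mul_zero, add_zero, Real.exp_zero] at h
  linarith

/-- **Rankin's trick for `G(R)`**: for a set `P` of primes `≤ R` and `σ > 0`,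
`G(R) ≥ ∏_{p ∈ P} (1 + h_p) - R^{-σ} ∏_{p ∈ P} (1 + h_p p^σ)`.
[cite: GreenTao2006Restriction, proof of Prop. 3.1 (i) (via Halberstam–Richert)] -/
theorem selbergG_ge_rankin {R : ℕ} (hR : 1 ≤ R) {P : Finset ℕ} (hP : P ⊆ Nat.primesLE R) {σ : ℝ}
    (hσ : 0 < σ) :
    ∏ p ∈ P, (1 + localH H p) - (R : ℝ) ^ (-σ) * ∏ p ∈ P, (1 + localH H p * (p : ℝ) ^ σ) ≤
      selbergG H R := by
  classical
  have hR0 : (0 : ℝ) < R := by exact_mod_cast hR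
  set h : Finset ℕ → ℝ := fun S => ∏ p ∈ S, localH H p with hh
  have hh0 : ∀ S ∈ P.powerset, 0 ≤ h S := fun S hS => Finset.prod_nonneg fun p hp =>
    localH_nonneg (Nat.prime_of_mem_primesLE (hP (Finset.mem_powerset.1 hS hp))).pos
  -- the level sets inside `P.powerset`
  have hsub : P.powerset.filter (fun S => ∏ p ∈ S, p ≤ R) ⊆ levelSets R := by
    intro S hS
    rw [Finset.mem_filter, Finset.mem_powerset] at hS
    exact mem_levelSets.2 ⟨hS.1.trans hP, hS.2⟩
  have h1 : ∑ S ∈ P.powerset.filter (fun S => ∏ p ∈ S, p ≤ R), h S ≤ selbergG H R :=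
    Finset.sum_le_sum_of_subset_of_nonneg hsub fun S hS _ => prod_localH_nonneg hS
  refine le_trans ?_ h1
  -- split the full sum over `P.powerset`
  have hsplit := Finset.sum_filter_add_sum_filter_not P.powerset (fun S => ∏ p ∈ S, p ≤ R) h
  have hfull : ∑ S ∈ P.powerset, h S = ∏ p ∈ P, (1 + localH H p) := by
    rw [Finset.prod_one_add]
  -- the tail: `∏ S > R`
  have htail : ∑ S ∈ P.powerset.filter (fun S => ¬ ∏ p ∈ S, p ≤ R), h S ≤
      (R : ℝ) ^ (-σ) * ∏ p ∈ P, (1 + localH H p * (p : ℝ) ^ σ) := by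
    have hexp : ∏ p ∈ P, (1 + localH H p * (p : ℝ) ^ σ) =
        ∑ S ∈ P.powerset, h S * ∏ p ∈ S, (p : ℝ) ^ σ := by
      rw [Finset.prod_one_add]
      refine Finset.sum_congr rfl fun S _ => ?_
      rw [hh, ← Finset.prod_mul_distrib]
    rw [hexp, Finset.mul_sum]
    calc ∑ S ∈ P.powerset.filter (fun S => ¬ ∏ p ∈ S, p ≤ R), h S
        ≤ ∑ S ∈ P.powerset.filter (fun S => ¬ ∏ p ∈ S, p ≤ R),
            (R : ℝ) ^ (-σ) * (h S * ∏ p ∈ S, (p : ℝ) ^ σ) := by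
          refine Finset.sum_le_sum fun S hS => ?_
          rw [Finset.mem_filter, not_le] at hS
          have hS0 := hh0 S hS.1
          have hbig : (R : ℝ) < ∏ p ∈ S, (p : ℝ) := by rw [← Nat.cast_prod]; exact_mod_cast hS.2
          have hprod : ∏ p ∈ S, (p : ℝ) ^ σ = (∏ p ∈ S, (p : ℝ)) ^ σ :=
            Real.finsetProd_rpow _ _ (fun p _ => Nat.cast_nonneg p) σ
          have hge : 1 ≤ (R : ℝ) ^ (-σ) * ∏ p ∈ S, (p : ℝ) ^ σ := by
            rw [hprod, Real.rpow_neg hR0.le, ← div_eq_inv_mul, ← Real.div_rpow (by positivity) hR0.le]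
            exact Real.one_le_rpow ((one_le_div hR0).2 hbig.le) hσ.le
          calc h S = h S * 1 := (mul_one _).symm
            _ ≤ h S * ((R : ℝ) ^ (-σ) * ∏ p ∈ S, (p : ℝ) ^ σ) := mul_le_mul_of_nonneg_left hge hS0
            _ = _ := by ring
      _ ≤ ∑ S ∈ P.powerset, (R : ℝ) ^ (-σ) * (h S * ∏ p ∈ S, (p : ℝ) ^ σ) :=
          Finset.sum_le_sum_of_subset_of_nonneg (Finset.filter_subset _ _) fun S hS _ =>
            mul_nonneg (Real.rpow_nonneg hR0.le _) (mul_nonneg (hh0 S hS)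
              (Finset.prod_nonneg fun p _ => Real.rpow_nonneg (Nat.cast_nonneg p) _))
  linarith

/-- The Rankin correction factor: `∏_{p ∈ P} (1 + h_p p^σ) ≤ ∏_{p ∈ P}(1 + h_p) · exp(∑_{p ∈ P} h_p (p^σ - 1))`
(`h_p ≥ 0`, `p^σ ≥ 1`). [folklore] -/
theorem prod_one_add_mul_rpow_le {P : Finset ℕ} (hP : ∀ p ∈ P, 0 ≤ localH H p ∧ 1 ≤ (p : ℝ))
    {σ : ℝ} (hσ : 0 ≤ σ) :
    ∏ p ∈ P, (1 + localH H p * (p : ℝ) ^ σ) ≤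
      (∏ p ∈ P, (1 + localH H p)) * Real.exp (∑ p ∈ P, localH H p * ((p : ℝ) ^ σ - 1)) := by
  rw [Real.exp_sum, ← Finset.prod_mul_distrib]
  refine Finset.prod_le_prod (fun p hp => ?_) fun p hp => ?_
  · have := (hP p hp).1; positivity
  · obtain ⟨hh, hp1⟩ := hP p hp
    have hpσ : 1 ≤ (p : ℝ) ^ σ := Real.one_le_rpow hp1 hσ
    have h1 : 1 + localH H p * (p : ℝ) ^ σ ≤ (1 + localH H p) * (1 + localH H p * ((p : ℝ) ^ σ - 1)) := by
      nlinarith [mul_nonneg hh (mul_nonneg hh (sub_nonneg.2 hpσ))]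
    refine h1.trans (mul_le_mul_of_nonneg_left ?_ (by positivity))
    linarith [Real.add_one_le_exp (localH H p * ((p : ℝ) ^ σ - 1))]

/-- The exponent in the Rankin correction is bounded: with `P` the primes `≤ w`, `w < z`, `z ≥ 2`,
and `σ = 1/log z`, `∑_{p ∈ P} h_p (p^σ - 1) ≤ 24 k²` (`h_p ≤ 4k²/p`, `p^σ - 1 ≤ 2 log p / log z`,
Mertens `∑_{p ≤ w} log p / p ≤ log w + log 4`). [cite: HardyWright2008, Thm 425] -/
theorem sum_localH_mul_rpow_sub_one_le (hadm : IsAdmissibleTuple H) (hk : 1 ≤ H.card) {w : ℕ}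
    (hw : 1 ≤ w) {z : ℝ} (hz : 2 ≤ z) (hwz : (w : ℝ) < z) :
    ∑ p ∈ Nat.primesLE w, localH H p * ((p : ℝ) ^ (1 / Real.log z) - 1) ≤ 24 * (H.card : ℝ) ^ 2 := by
  have hlogz : 0 < Real.log z := Real.log_pos (by linarith)
  have hlog2 : Real.log 2 ≤ Real.log z := Real.log_le_log two_pos hz
  have hlog2pos : 0 < Real.log 2 := Real.log_pos one_lt_two
  have hlog4 : Real.log 4 = 2 * Real.log 2 := by
    rw [show (4 : ℝ) = 2 ^ 2 by norm_num, Real.log_pow]; ring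
  -- termwise bound
  have hterm : ∀ p ∈ Nat.primesLE w, localH H p * ((p : ℝ) ^ (1 / Real.log z) - 1) ≤
      (8 * (H.card : ℝ) ^ 2 / Real.log z) * (Real.log p / p) := by
    intro p hp
    have hprime := Nat.prime_of_mem_primesLE hp
    have hp2 : (2 : ℝ) ≤ p := by exact_mod_cast hprime.two_le
    have hp0 : (0 : ℝ) < p := by linarith
    have hlogp : 0 ≤ Real.log p := Real.log_nonneg (by linarith)
    -- `t = log p / log z ∈ [0, 1]`
    set t : ℝ := Real.log p / Real.log z with ht
    have ht0 : 0 ≤ t := div_nonneg hlogp hlogz.le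
    have ht1 : t ≤ 1 := by
      rw [ht, div_le_one hlogz]
      have hpw : (p : ℝ) ≤ w := by exact_mod_cast Nat.le_of_mem_primesLE hp
      exact Real.log_le_log hp0 (by linarith)
    have hpσ : (p : ℝ) ^ (1 / Real.log z) - 1 ≤ 2 * t := by
      rw [Real.rpow_def_of_pos hp0, show Real.log p * (1 / Real.log z) = t by rw [ht]; ring]
      have := exp_le_one_add_mul ht0 ht1
      have he : Real.exp 1 - 1 ≤ 2 := by linarith [Real.exp_one_lt_d9]
      nlinarith
    have hpσ0 : 0 ≤ (p : ℝ) ^ (1 / Real.log z) - 1 :=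
      sub_nonneg.2 (Real.one_le_rpow (by linarith) (by positivity))
    have hh := localH_le hadm hk hprime
    have hh0 := localH_nonneg (H := H) hprime.pos
    calc localH H p * ((p : ℝ) ^ (1 / Real.log z) - 1) ≤ (4 * (H.card : ℝ) ^ 2 / p) * (2 * t) :=
          mul_le_mul hh hpσ hpσ0 (by positivity)
      _ = (8 * (H.card : ℝ) ^ 2 / Real.log z) * (Real.log p / p) := by
          rw [ht]; field_simp; ring
  refine (Finset.sum_le_sum hterm).trans ?_
  rw [← Finset.mul_sum]
  have hM := Literature.NumberTheory.LFunctions.MertensBound.sum_log_div_prime_le w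
  have hlogw : Real.log w ≤ Real.log z := Real.log_le_log (by exact_mod_cast hw) hwz.le
  calc 8 * (H.card : ℝ) ^ 2 / Real.log z * ∑ p ∈ Nat.primesLE w, Real.log p / p
      ≤ 8 * (H.card : ℝ) ^ 2 / Real.log z * (Real.log z + 2 * Real.log z) := by
        refine mul_le_mul_of_nonneg_left ?_ (by positivity)
        linarith
    _ = 24 * (H.card : ℝ) ^ 2 := by field_simp; ring

/-- **Rankin lower bound**: for `m ≥ 24k² + 1` and `R ≥ 2^m`, with `z = R^{1/m}` and
`w = ⌈z⌉ - 1` (the primes `< z` are the primes `≤ w`), `G(R) ≥ ½ ∏_{p ≤ w} (1 + h_p)`.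
[cite: GreenTao2006Restriction, proof of Prop. 3.1 (i)] -/
theorem selbergG_ge_half_prod (hadm : IsAdmissibleTuple H) (hk : 1 ≤ H.card) {m : ℕ}
    (hm : 24 * (H.card : ℝ) ^ 2 + 1 ≤ m) {R : ℕ} (hR : (2 : ℝ) ^ m ≤ R) :
    (1 / 2) * ∏ p ∈ Nat.primesLE (⌈(R : ℝ) ^ (1 / (m : ℝ))⌉₊ - 1), (1 + localH H p) ≤ selbergG H R := by
  have hm1 : (1 : ℝ) ≤ m := by nlinarith
  have hm0 : (0 : ℝ) < m := by linarith
  have hR1 : (1 : ℝ) < R := by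
    have : (2 : ℝ) ≤ 2 ^ m := by
      calc (2 : ℝ) = 2 ^ (1 : ℕ) := by norm_num
        _ ≤ 2 ^ m := pow_le_pow_right₀ (by norm_num) (by exact_mod_cast hm1)
    linarith
  have hR0 : (0 : ℝ) < R := by linarith
  have hRn : 1 ≤ R := by exact_mod_cast hR1.le
  set z : ℝ := (R : ℝ) ^ (1 / (m : ℝ)) with hz
  have hz2 : 2 ≤ z := by
    rw [hz]
    calc (2 : ℝ) = ((2 : ℝ) ^ (m : ℝ)) ^ (1 / (m : ℝ)) := by
          rw [← Real.rpow_mul (by norm_num), mul_one_div_cancel hm0.ne', Real.rpow_one]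
      _ ≤ (R : ℝ) ^ (1 / (m : ℝ)) := by
          refine Real.rpow_le_rpow (by positivity) ?_ (by positivity)
          rwa [Real.rpow_natCast]
  have hlogz : Real.log z = Real.log R / m := by
    rw [hz, Real.log_rpow hR0]; ring
  have hlogz0 : 0 < Real.log z := Real.log_pos (by linarith)
  set w : ℕ := ⌈z⌉₊ - 1 with hw
  have hceil1 : 1 ≤ ⌈z⌉₊ := Nat.one_le_iff_ne_zero.2 (by
    intro h0; rw [Nat.ceil_eq_zero] at h0; linarith)
  have hwz : (w : ℝ) < z := by
    have := Nat.ceil_lt_add_one (by linarith : (0 : ℝ) ≤ z)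
    rw [hw]; push_cast [Nat.cast_sub hceil1]; linarith
  have hw1 : 1 ≤ w := by
    have h2 : 1 < ⌈z⌉₊ := Nat.lt_ceil.2 (by push_cast; linarith)
    omega
  have hwR : Nat.primesLE w ⊆ Nat.primesLE R := by
    intro p hp
    rw [Nat.mem_primesLE] at hp ⊢
    refine ⟨?_, hp.2⟩
    have h1 : (p : ℝ) < z := lt_of_le_of_lt (by exact_mod_cast hp.1) hwz
    have h2 : z ≤ R := by
      rw [hz]
      calc (R : ℝ) ^ (1 / (m : ℝ)) ≤ (R : ℝ) ^ (1 : ℝ) :=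
            Real.rpow_le_rpow_of_exponent_le hR1.le (by rw [div_le_one hm0]; exact hm1)
        _ = R := Real.rpow_one _
    exact_mod_cast (h1.trans_le h2).le
  -- Rankin
  set σ : ℝ := 1 / Real.log z with hσ
  have hσ0 : 0 < σ := by positivity
  have hrank := selbergG_ge_rankin (H := H) hRn hwR hσ0
  have hratio := prod_one_add_mul_rpow_le (H := H) (P := Nat.primesLE w) (fun p hp =>
    ⟨localH_nonneg (Nat.prime_of_mem_primesLE hp).pos,
      by exact_mod_cast (Nat.prime_of_mem_primesLE hp).one_le⟩) hσ0.le
  have hsum := sum_localH_mul_rpow_sub_one_le hadm hk hw1 hz2 hwz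
  have hlogR : Real.log R ≠ 0 := (Real.log_pos hR1).ne'
  have hRσ : (R : ℝ) ^ (-σ) = Real.exp (-(m : ℝ)) := by
    rw [Real.rpow_def_of_pos hR0, hσ, hlogz]
    congr 1; field_simp
  set P1 := ∏ p ∈ Nat.primesLE w, (1 + localH H p) with hP1
  have hP10 : 0 ≤ P1 := Finset.prod_nonneg fun p hp => by
    have := localH_nonneg (H := H) (Nat.prime_of_mem_primesLE hp).pos; linarith
  have hcorr : (R : ℝ) ^ (-σ) * ∏ p ∈ Nat.primesLE w, (1 + localH H p * (p : ℝ) ^ σ) ≤ P1 / 2 := by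
    rw [hRσ]
    calc Real.exp (-(m : ℝ)) * ∏ p ∈ Nat.primesLE w, (1 + localH H p * (p : ℝ) ^ σ)
        ≤ Real.exp (-(m : ℝ)) * (P1 * Real.exp (24 * (H.card : ℝ) ^ 2)) := by
          refine mul_le_mul_of_nonneg_left (hratio.trans ?_) (Real.exp_pos _).le
          exact mul_le_mul_of_nonneg_left (Real.exp_le_exp.2 hsum) hP10
      _ = P1 * Real.exp (24 * (H.card : ℝ) ^ 2 - m) := by rw [Real.exp_sub, Real.exp_neg]; ring
      _ ≤ P1 * (1 / 2) := by
          refine mul_le_mul_of_nonneg_left ?_ hP10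
          calc Real.exp (24 * (H.card : ℝ) ^ 2 - m) ≤ Real.exp (-1) := Real.exp_le_exp.2 (by linarith)
            _ ≤ 1 / 2 := by
                rw [Real.exp_neg, inv_eq_one_div, div_le_div_iff_of_pos_left one_pos (Real.exp_pos 1) two_pos]
                linarith [Real.exp_one_gt_d9]
      _ = P1 / 2 := by ring
  linarith


/-- The Euler factor of the singular series at a prime `p > k`: `F_p ≥ 1 - k²/p²`
(`ν_p ≤ k`, `(1 - 1/p)^{-k} ≥ 1 + k/p`). [cite: HalberstamRichert1974, Ch. 10] -/
theorem singularSeriesFactor_ge {p : ℕ} (hp : p.Prime) (hpk : H.card < p) :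
    1 - (H.card : ℝ) ^ 2 / (p : ℝ) ^ 2 ≤ singularSeriesFactor H p := by
  have hp0 : (0 : ℝ) < p := by exact_mod_cast hp.pos
  have hp1 : (1 : ℝ) < p := by exact_mod_cast hp.one_lt
  have hk : (H.card : ℝ) < p := by exact_mod_cast hpk
  have hν : (tupleResidueCount H p : ℝ) ≤ H.card := by exact_mod_cast tupleResidueCount_le_card H p
  unfold singularSeriesFactor
  have h1 : 1 - (H.card : ℝ) / p ≤ 1 - (tupleResidueCount H p : ℝ) / p := by
    gcongr
  have h2 : 1 + (H.card : ℝ) / p ≤ (1 - 1 / (p : ℝ))⁻¹ ^ H.card := by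
    have hinv : 1 + 1 / (p : ℝ) ≤ (1 - 1 / (p : ℝ))⁻¹ := by
      rw [show (1 - 1 / (p : ℝ))⁻¹ = p / (p - 1) by field_simp, le_div_iff₀ (by linarith)]
      field_simp
      nlinarith
    calc 1 + (H.card : ℝ) / p = 1 + H.card * (1 / p) := by ring
      _ ≤ (1 + 1 / (p : ℝ)) ^ H.card :=
          one_add_mul_le_pow (by linarith [show (0 : ℝ) ≤ 1 / p from by positivity]) _
      _ ≤ (1 - 1 / (p : ℝ))⁻¹ ^ H.card := pow_le_pow_left₀ (by positivity) hinv _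
  have h3 : 0 ≤ 1 - (H.card : ℝ) / p := by rw [sub_nonneg, div_le_one hp0]; exact hk.le
  calc 1 - (H.card : ℝ) ^ 2 / (p : ℝ) ^ 2 = (1 - (H.card : ℝ) / p) * (1 + (H.card : ℝ) / p) := by
        field_simp; ring
    _ ≤ (1 - (tupleResidueCount H p : ℝ) / p) * (1 - 1 / (p : ℝ))⁻¹ ^ H.card :=
        mul_le_mul h1 h2 (by positivity) (h3.trans h1)

/-- **The singular series is comparable to its partial product**: for `w + 1 ≥ 4k²`,
`𝔖(H) ≥ ½ ∏_{p ≤ w} F_p` (the tail `∏_{p>w} F_p ≥ 1 - k² ∑_{p>w} p⁻² ≥ ½`).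
[cite: HalberstamRichert1974, Ch. 10] -/
theorem half_prod_le_singularSeries {w : ℕ} (hw : 4 * H.card ^ 2 ≤ w + 1) (hw1 : 1 ≤ w) :
    (1 / 2) * ∏ p ∈ Nat.primesLE w, singularSeriesFactor H p ≤ singularSeries H := by
  classical
  have hk2 : H.card ≤ w := by nlinarith
  have hpart : ∀ x : ℕ, w ≤ x → (1 / 2) * ∏ p ∈ Nat.primesLE w, singularSeriesFactor H p ≤
      singularSeriesPartial H x := by
    intro x hx
    have hsplit : singularSeriesPartial H x = (∏ p ∈ Nat.primesLE w, singularSeriesFactor H p) *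
        ∏ p ∈ (Nat.primesLE x).filter (fun p => ¬ p ≤ w), singularSeriesFactor H p := by
      rw [singularSeriesPartial, ← Finset.prod_filter_mul_prod_filter_not (Nat.primesLE x) (fun p => p ≤ w)]
      congr 1
      congr 1
      ext p
      simp only [Finset.mem_filter, Nat.mem_primesLE]
      constructor
      · rintro ⟨⟨-, hp⟩, hpw⟩; exact ⟨hpw, hp⟩
      · rintro ⟨hpw, hp⟩; exact ⟨⟨hpw.trans hx, hp⟩, hpw⟩
    rw [hsplit, mul_comm]
    refine mul_le_mul_of_nonneg_left ?_ (Finset.prod_nonneg fun p hp =>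
      singularSeriesFactor_nonneg H (Nat.prime_of_mem_primesLE hp))
    -- the tail is at least `1/2`
    set T := (Nat.primesLE x).filter (fun p => ¬ p ≤ w) with hT
    have hTmem : ∀ p ∈ T, p.Prime ∧ w < p ∧ p ≤ x := by
      intro p hp
      rw [hT, Finset.mem_filter, Nat.mem_primesLE, not_le] at hp
      exact ⟨hp.1.2, hp.2, hp.1.1⟩
    have h1 : ∏ p ∈ T, (1 - (H.card : ℝ) ^ 2 / (p : ℝ) ^ 2) ≤ ∏ p ∈ T, singularSeriesFactor H p := by
      refine Finset.prod_le_prod (fun p hp => ?_) fun p hp => ?_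
      · obtain ⟨hp', hwp, -⟩ := hTmem p hp
        have : (H.card : ℝ) < p := by exact_mod_cast hk2.trans_lt hwp
        have hp0 : (0 : ℝ) < p := by exact_mod_cast hp'.pos
        rw [sub_nonneg, div_le_one (by positivity)]
        nlinarith
      · obtain ⟨hp', hwp, -⟩ := hTmem p hp
        exact singularSeriesFactor_ge hp' (hk2.trans_lt hwp)
    refine le_trans ?_ h1
    -- Weierstrass `1 - ∑ aᵢ ≤ ∏ (1 - aᵢ)` for `0 ≤ aᵢ ≤ 1` (cf. the tree's `one_sub_sum_le_prod`)
    have weier : ∀ (S : Finset ℕ) (a : ℕ → ℝ), (∀ i ∈ S, 0 ≤ a i) → (∀ i ∈ S, a i ≤ 1) →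
        1 - ∑ i ∈ S, a i ≤ ∏ i ∈ S, (1 - a i) := by
      intro S a
      induction S using Finset.induction_on with
      | empty => intro _ _; simp
      | insert j S hj ih =>
        intro h0 h1'
        rw [Finset.sum_insert hj, Finset.prod_insert hj]
        have h0' : ∀ i ∈ S, 0 ≤ a i := fun i hi => h0 i (Finset.mem_insert_of_mem hi)
        have h1'' : ∀ i ∈ S, a i ≤ 1 := fun i hi => h1' i (Finset.mem_insert_of_mem hi)
        have ih' := ih h0' h1''
        have hP : ∏ i ∈ S, (1 - a i) ≤ 1 := Finset.prod_le_one (fun i hi => by linarith [h1'' i hi])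
          fun i hi => by linarith [h0' i hi]
        have hP0 : 0 ≤ ∏ i ∈ S, (1 - a i) := Finset.prod_nonneg fun i hi => by linarith [h1'' i hi]
        have ha0 := h0 j (Finset.mem_insert_self j S)
        have ha1 := h1' j (Finset.mem_insert_self j S)
        nlinarith
    have h2 := weier T (fun p => (H.card : ℝ) ^ 2 / (p : ℝ) ^ 2)
      (fun p _ => by positivity) (fun p hp => by
        obtain ⟨hp', hwp, -⟩ := hTmem p hp
        have : (H.card : ℝ) < p := by exact_mod_cast hk2.trans_lt hwp
        have hp0 : (0 : ℝ) < p := by exact_mod_cast hp'.pos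
        rw [div_le_one (by positivity)]
        nlinarith)
    refine le_trans ?_ h2
    have h3 : ∑ p ∈ T, (H.card : ℝ) ^ 2 / (p : ℝ) ^ 2 ≤ (H.card : ℝ) ^ 2 * (2 / ((w : ℝ) + 1)) := by
      rw [show ∑ p ∈ T, (H.card : ℝ) ^ 2 / (p : ℝ) ^ 2 = (H.card : ℝ) ^ 2 * ∑ p ∈ T, ((p : ℝ) ^ 2)⁻¹ by
        rw [Finset.mul_sum]; exact Finset.sum_congr rfl fun p _ => by ring]
      refine mul_le_mul_of_nonneg_left ?_ (by positivity)
      calc ∑ p ∈ T, ((p : ℝ) ^ 2)⁻¹ ≤ ∑ i ∈ Finset.Ioo w (x + 1), ((i : ℝ) ^ 2)⁻¹ := by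
            refine Finset.sum_le_sum_of_subset_of_nonneg (fun p hp => ?_) fun i _ _ => by positivity
            obtain ⟨-, hwp, hpx⟩ := hTmem p hp
            rw [Finset.mem_Ioo]; omega
        _ ≤ 2 / ((w : ℝ) + 1) := sum_Ioo_inv_sq_le w (x + 1)
    have hw' : (4 : ℝ) * (H.card : ℝ) ^ 2 ≤ w + 1 := by exact_mod_cast hw
    have hw0 : (0 : ℝ) < w + 1 := by positivity
    have : (H.card : ℝ) ^ 2 * (2 / ((w : ℝ) + 1)) ≤ 1 / 2 := by
      rw [mul_div_assoc', div_le_iff₀ hw0]; linarith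
    linarith
  exact ge_of_tendsto (tendsto_singularSeriesPartial_holds H) (Filter.eventually_atTop.2 ⟨w, hpart⟩)

/-- **Mertens' third theorem, lower half** (from the tree's interval bound):
`log w / (e^{6/log 2} log 2) ≤ (∏_{p ≤ w} (1 - 1/p))⁻¹` for `w ≥ 2`.
[cite: HardyWright2008, Thm 429] -/
theorem log_div_le_inv_prod_one_sub {w : ℕ} (hw : 2 ≤ w) :
    Real.log w / (Real.exp (6 / Real.log 2) * Real.log 2) ≤
      (∏ p ∈ Nat.primesLE w, (1 - (p : ℝ)⁻¹))⁻¹ := by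
  have hw2 : (2 : ℝ) ≤ w := by exact_mod_cast hw
  have h := Literature.NumberTheory.LFunctions.MertensBound.prod_one_sub_inv_prime_Icc_le
    (le_refl (2 : ℝ)) hw2
  have hset : (Icc ⌈(2 : ℝ)⌉₊ ⌊(w : ℝ)⌋₊).filter Nat.Prime = Nat.primesLE w := by
    rw [Nat.ceil_ofNat, Nat.floor_natCast]
    ext p
    simp only [Finset.mem_filter, Finset.mem_Icc, Nat.mem_primesLE]
    exact ⟨fun h => ⟨h.1.2, h.2⟩, fun h => ⟨⟨h.2.two_le, h.1⟩, h.2⟩⟩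
  rw [hset] at h
  have hlog2 : 0 < Real.log 2 := Real.log_pos one_lt_two
  have hlogw : 0 < Real.log w := Real.log_pos (by linarith)
  have hpos : 0 < ∏ p ∈ Nat.primesLE w, (1 - (p : ℝ)⁻¹) := by
    refine Finset.prod_pos fun p hp => ?_
    have : (2 : ℝ) ≤ p := by exact_mod_cast (Nat.prime_of_mem_primesLE hp).two_le
    have : (p : ℝ)⁻¹ ≤ 1 / 2 := by rw [inv_eq_one_div]; exact one_div_le_one_div_of_le two_pos this
    linarith
  calc Real.log w / (Real.exp (6 / Real.log 2) * Real.log 2)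
      = (Real.exp (6 / Real.log 2) * (Real.log 2 / Real.log w))⁻¹ := by field_simp
    _ ≤ (∏ p ∈ Nat.primesLE w, (1 - (p : ℝ)⁻¹))⁻¹ := inv_anti₀ hpos h

/-- `(1 + h_p) F_p = (1 - 1/p)^{-k}` at a prime with `ν_p < p`. [cite: GreenTao2006Restriction, (1.4) and (7.12)] -/
theorem one_add_localH_mul_factor (hadm : IsAdmissibleTuple H) {p : ℕ} (hp : p.Prime) :
    (1 + localH H p) * singularSeriesFactor H p = (1 - 1 / (p : ℝ))⁻¹ ^ H.card := by
  have hp0 : (0 : ℝ) < p := by exact_mod_cast hp.pos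
  have hν : (tupleResidueCount H p : ℝ) < p := by exact_mod_cast hadm p hp
  unfold localH singularSeriesFactor
  have h1 : (p : ℝ) - tupleResidueCount H p ≠ 0 := by linarith
  rw [← mul_assoc]
  have : (1 + (tupleResidueCount H p : ℝ) / (p - tupleResidueCount H p)) *
      (1 - (tupleResidueCount H p : ℝ) / p) = 1 := by
    field_simp; ring
  rw [this, one_mul]

/-- **GT Prop. 3.1 (i): the lower bound for `G(R)`.**  For every `k ≥ 1` there are `c > 0` and
`R₀` such that `G(R) ≥ c (log R)^k / 𝔖(H)` for every admissible `k`-tuple `H` and every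
`R ≥ R₀` (GT: "`β(n) ≫_k 𝔖_F⁻¹ log^k R 1_{X_{R!}}(n)`", via `β = G(R)` on `X_{R!}` and the
Halberstam–Richert bound `G(R) ≫_k ∏_{p<R} γ(p)⁻¹`).  Here `c = ¼ (c₀/(2m))^k`,
`m = 24k² + 1`, `c₀ = e^{-6/log 2}/log 2`, `R₀ = (4k²+4)^m`.
[cite: GreenTao2006Restriction, Prop. 3.1 (i) and its proof in §7] -/
theorem selbergG_ge (k : ℕ) (hk : 1 ≤ k) :
    ∃ c : ℝ, 0 < c ∧ ∃ R₀ : ℕ, ∀ (H : Finset ℤ) (R : ℕ), H.card = k → IsAdmissibleTuple H →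
      R₀ ≤ R → c * Real.log R ^ k / singularSeries H ≤ selbergG H R := by
  set m : ℕ := 24 * k ^ 2 + 1 with hm
  set c₀ : ℝ := 1 / (Real.exp (6 / Real.log 2) * Real.log 2) with hc₀
  have hlog2 : 0 < Real.log 2 := Real.log_pos one_lt_two
  have hc₀0 : 0 < c₀ := by rw [hc₀]; positivity
  have hm0 : (0 : ℝ) < m := by rw [hm]; positivity
  have hm1 : (1 : ℝ) ≤ m := by rw [hm]; push_cast; nlinarith
  refine ⟨(1 / 4) * (c₀ / (2 * m)) ^ k, by positivity, (4 * k ^ 2 + 4) ^ m, ?_⟩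
  intro H R hcard hadm hR
  have hk' : 1 ≤ H.card := hcard ▸ hk
  -- sizes
  have hB : (4 : ℝ) * k ^ 2 + 4 ≤ (R : ℝ) ^ (1 / (m : ℝ)) := by
    have h1 : ((4 * k ^ 2 + 4 : ℕ) : ℝ) ^ (m : ℝ) ≤ R := by
      rw [Real.rpow_natCast]; exact_mod_cast hR
    calc (4 : ℝ) * k ^ 2 + 4 = ((((4 * k ^ 2 + 4 : ℕ) : ℝ)) ^ (m : ℝ)) ^ (1 / (m : ℝ)) := by
          rw [← Real.rpow_mul (by positivity), mul_one_div_cancel hm0.ne', Real.rpow_one]; push_cast; ring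
      _ ≤ (R : ℝ) ^ (1 / (m : ℝ)) := Real.rpow_le_rpow (by positivity) h1 (by positivity)
  have hk1 : (1 : ℝ) ≤ k := by exact_mod_cast hk
  set z : ℝ := (R : ℝ) ^ (1 / (m : ℝ)) with hz
  have hz8 : 8 ≤ z := by nlinarith
  have hR2m : (2 : ℝ) ^ m ≤ R := by
    have : ((2 ^ m : ℕ) : ℝ) ≤ ((4 * k ^ 2 + 4) ^ m : ℕ) := by
      exact_mod_cast Nat.pow_le_pow_left (by nlinarith) m
    push_cast at this
    exact this.trans (by exact_mod_cast hR)
  have hR1 : (1 : ℝ) < R := by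
    have : (2 : ℝ) ≤ 2 ^ m := by
      calc (2 : ℝ) = 2 ^ (1 : ℕ) := by norm_num
        _ ≤ 2 ^ m := pow_le_pow_right₀ (by norm_num) (by rw [hm]; omega)
    linarith
  have hR0 : (0 : ℝ) < R := by linarith
  have hRn : 1 ≤ R := by exact_mod_cast hR1.le
  have hlogz : Real.log z = Real.log R / m := by rw [hz, Real.log_rpow hR0]; ring
  set w : ℕ := ⌈z⌉₊ - 1 with hw
  have hceil1 : 1 ≤ ⌈z⌉₊ := (Nat.lt_ceil.2 (by push_cast; linarith)).le
  have hwz : (w : ℝ) < z := by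
    have := Nat.ceil_lt_add_one (by linarith : (0 : ℝ) ≤ z)
    rw [hw]; push_cast [Nat.cast_sub hceil1]; linarith
  have hzw : z - 1 ≤ w := by
    have := Nat.le_ceil z
    rw [hw]; push_cast [Nat.cast_sub hceil1]; linarith
  have hw4 : 4 * H.card ^ 2 ≤ w + 1 := by
    rw [hcard]
    have : (4 : ℝ) * k ^ 2 ≤ (w : ℝ) + 1 := by linarith
    exact_mod_cast this
  have hw2 : 2 ≤ w := by
    have : (2 : ℝ) ≤ w := by linarith
    exact_mod_cast this
  -- the three bounds
  have hmH : 24 * (H.card : ℝ) ^ 2 + 1 ≤ m := by rw [hcard, hm]; push_cast; exact le_refl _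
  have hG := selbergG_ge_half_prod hadm hk' hmH hR2m
  have hS := half_prod_le_singularSeries (H := H) hw4 (by omega)
  have hSpos : 0 < singularSeries H := (singularSeries_pos_iff_holds H).2 hadm
  have hM := log_div_le_inv_prod_one_sub hw2
  -- combine
  rw [div_le_iff₀ hSpos]
  have hP1 : 0 ≤ ∏ p ∈ Nat.primesLE w, (1 + localH H p) := Finset.prod_nonneg fun p hp => by
    have := localH_nonneg (H := H) (Nat.prime_of_mem_primesLE hp).pos; linarith
  have hkey : (∏ p ∈ Nat.primesLE w, (1 + localH H p)) * ∏ p ∈ Nat.primesLE w, singularSeriesFactor H p =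
      ((∏ p ∈ Nat.primesLE w, (1 - (p : ℝ)⁻¹))⁻¹) ^ k := by
    rw [← Finset.prod_mul_distrib, ← Finset.prod_inv_distrib, ← Finset.prod_pow]
    refine Finset.prod_congr rfl fun p hp => ?_
    rw [one_add_localH_mul_factor hadm (Nat.prime_of_mem_primesLE hp), hcard, one_div]
  have hlogw : c₀ * (Real.log R / (2 * m)) ≤ (∏ p ∈ Nat.primesLE w, (1 - (p : ℝ)⁻¹))⁻¹ := by
    refine le_trans ?_ hM
    rw [hc₀, one_div, ← div_eq_inv_mul]
    refine div_le_div_of_nonneg_right ?_ (by positivity)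
    -- `log R / (2m) ≤ log w`: `w ≥ z - 1 ≥ z/2`, `log z = log R / m`
    have h1 : z / 2 ≤ w := by linarith
    have h2 : Real.log (z / 2) ≤ Real.log w := Real.log_le_log (by linarith) h1
    rw [Real.log_div (by linarith) two_ne_zero, hlogz] at h2
    have h3 : Real.log 2 ≤ Real.log R / (2 * m) := by
      -- `z ≥ 8 ≥ 4` so `log z ≥ 2 log 2`
      have : Real.log 4 ≤ Real.log z := Real.log_le_log (by norm_num) (by linarith)
      rw [show (4 : ℝ) = 2 ^ 2 by norm_num, Real.log_pow, hlogz] at this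
      push_cast at this
      rw [le_div_iff₀ (by positivity)]
      rw [le_div_iff₀ hm0] at this
      linarith
    have h4 : Real.log R / (2 * m) = Real.log R / m - Real.log R / (2 * m) := by field_simp; ring
    linarith
  have hck : (c₀ * (Real.log R / (2 * m))) ^ k ≤ ((∏ p ∈ Nat.primesLE w, (1 - (p : ℝ)⁻¹))⁻¹) ^ k :=
    pow_le_pow_left₀ (by positivity) hlogw k
  have hpw : (c₀ / (2 * m)) ^ k * Real.log R ^ k = (c₀ * (Real.log R / (2 * m))) ^ k := by
    rw [← mul_pow]; congr 1; ring
  calc (1 / 4) * (c₀ / (2 * m)) ^ k * Real.log R ^ k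
      = (1 / 4) * (c₀ * (Real.log R / (2 * m))) ^ k := by rw [mul_assoc, hpw]
    _ ≤ (1 / 4) * ((∏ p ∈ Nat.primesLE w, (1 - (p : ℝ)⁻¹))⁻¹) ^ k :=
        mul_le_mul_of_nonneg_left hck (by norm_num)
    _ = ((1 / 2) * ∏ p ∈ Nat.primesLE w, (1 + localH H p)) *
          ((1 / 2) * ∏ p ∈ Nat.primesLE w, singularSeriesFactor H p) := by rw [← hkey]; ring
    _ ≤ selbergG H R * ((1 / 2) * ∏ p ∈ Nat.primesLE w, singularSeriesFactor H p) :=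
        mul_le_mul_of_nonneg_right hG (mul_nonneg (by norm_num) (Finset.prod_nonneg fun p hp =>
          singularSeriesFactor_nonneg H (Nat.prime_of_mem_primesLE hp)))
    _ ≤ selbergG H R * singularSeries H :=
        mul_le_mul_of_nonneg_left hS (selbergG_nonneg R)

end GreenTao2006

end Literature.NumberTheory.Sieve
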